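import Summits.QuantumFields.YangMills.Theorems.BalabanUVNodesN15KingModelCurvedH

/-!
# BalabanUVNodes ∕ N15 — THE KING-MODEL RUNG, CURVED EDITION (PART B): THE DICTIONARY «NE2's typed site inequality for the H-kernel
# ≡ King's printed (3.71), line 1, up to constants» on every blocked two-spacing datum WITH THE BACKGROUND, `NE2PlusSite` on Prop-3.8
# families BY NAME FROM `King1986.SlicePropagator.Prop38Printed`, the readout, and the one-point member
# (Track A, DAG node N15 = NE2; FAN-OUT v1.1 §N15 s3 «KING-MODEL RUNG … + the one-line statement of what the curved case adds»)

HONEST FRAMING.  Count-neutral kernel bookkeeping (cell `pub-ymgap`, seat `pub-ymgap-dag-n15-e` g3; `--supports stmt-QuantumFields-19792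
--as helper` = K3′ `SpineGivenEndpointR12`, lineage K3 19676).  Input = the HYPOTHESIS SCHEMA `SlicePropagator.Prop38Printed T C δ₀ γ` ([King1986] Prop. 3.8 p. 664, King's
U(1)-Higgs model `d = 2, 3` WITH background, printed and proved in print, typed over abstract data by the literature seat) — CONSUMED by name,
not proved; NOT Bałaban's covariant `H_k(U)` ([Balaban1985BackgroundPropagators] Sect. D), for which NE2⁺ is NOT PRINTED and not proved; NOT a
node discharge; nothing continuum ∕ ℝ⁴ ∕ OS ∕ mass-gap ∕ Clay.  0 `sorry`, standard axioms; plumbing `def`s: a one-point member and its family.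

THE POINT (continuing part A `…N15KingModelCurvedH`: the unit-block structure `UnitBlocking`, the unit-lattice carriers `curvedGeo` ∕
`curvedInstance`, the sup entries `hEntry` ∕ `dhEntry` and site kernels `curvedHSite` ∕ `curvedDHSite`, and the step bounds from print
`hEntry_le_of_prop38Printed` ∕ `dhEntry_le_of_prop38Printed`).
* §3 THE DICTIONARY on the unit-lattice carrier: `EtaRateIneqSite d′ p Kd C δ γ U` IS `∀ y z, |Kd(y, z)| ≤ C·e^{−δ|y−z|}·L^{−γk}`
  (`etaRateIneqSite_curved_iff`: every `len = 1`, both rate factors King's `L^{−γk}`); hence a line-1 bound ⇒ the typed site inequality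
  (`etaRateIneqSite_curvedH_of_line1`), **`etaRateIneqSite_curvedH_of_prop38Printed`** (constants `(C·e^{δ₀D₀}, δ₀, γ)`, every `(d′, p)`),
  `etaRateIneqSite_curvedDH_of_prop38Printed` (`(d+1)·C·e^{δ₀D₀}`), and CONVERSELY **`line1_of_etaRateIneqSite_curvedH`**: the typed site
  inequality for the H-kernel's sup entry RETURNS (3.71) line 1's printed shape at EVERY fine point, with the block slack `e^{δD₀}` — on every
  blocked two-spacing datum the two statements are the same up to the constants `e^{±δD₀}`;
* §4 PACKAGED under the node's quantifier block: **`ne2PlusSite_curvedH_of_prop38Printed`** ∕ `ne2PlusSite_curvedDH_of_prop38Printed` — on ANY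
  family `D : ι → CurvedIndex d D₀` obeying Prop. 3.8 with COMMON constants (King: *"C depends on g, h"* — uniform over the regular
  backgrounds, i.e. over the index), `NE2PlusSite d′ p c35` holds for the H-kernel's η-difference sup entries, guards `(M₅, a₀) = (1, 1)`;
  `ne2PlusSite_curvedH_of_line1` (minimal hypothesis); `ne2ZeroSite_curvedH_of_prop38Printed`; `ne2PlusSite_curvedH_iff_zero` (part 2 §3:
  on a one-point background sort NE2⁺ ⟺ NE2⁰ — what Bałaban's live window adds at the type level); and THE READOUT **`exists_line1_of_ne2PlusSite`**:
  on any family the packaged type RETURNS line 1's shape with common positive constants at every member above a cube-size threshold `M₅`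
  ([B9] Thm 3.1's «for M ≥ M₁» frame) — neither vacuous nor more than line 1 up to constants;
* §5 the index is inhabited: the one-point zero-kernel member (`prop38Printed_pt`, `curvedIndex_nonempty`), its co-final family `ptFamily`,
  and the smoke test `ne2PlusSite_ptFamily`.
WHAT BAŁABAN'S CASE STILL ADDS and HONEST SCOPE (i)–(iv): as part A's header — non-abelian covariant `H_k(U)`, the multiscale `𝔅` with
(3.133)'s prefactors, the live window `∀ U, Reg335 …` inside one instance, an η-difference statement at all; lines 3–4 of (3.71) carried
not consumed; unit observation sites reading every fine point of the block; the unit-block structure posited abstractly; Prop. 3.9 not read.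
Locators: [King1986] C. King, CMP **102** (1986) 649–677: p. 656, p. 664 + Prop. 3.8 (3.71) p. 664, §4 p. 674; [B9] =
[Balaban1985BackgroundPropagators] CMP **99** (1985): (3.35) p. 396, Thm 3.1 p. 397, Thm 3.2 (3.48) p. 398, Thm 3.4 p. 400, (3.133) p. 422,
Thm 3.14 pp. 426–427 (typing template).
-/

noncomputable section

namespace Summit.QuantumFields.YangMills.BalabanUVNodes.N15KingModelRung.Curved

open Real Finset
open Literature.MathematicalPhysics.QuantumFieldTheory.Balaban1983to89
open Literature.MathematicalPhysics.QuantumFieldTheory.Balaban1983to89.T4EtaRate (PairedInstance EtaPairing EtaRateIneqSite NE2PlusSite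
  rateFactor rateFactor_unit)
open Literature.MathematicalPhysics.QuantumFieldTheory.Balaban1983to89.T4EtaRateSiteOfRatePair (NE2ZeroSite ne2ZeroSite_of_ne2PlusSite)
open Literature.MathematicalPhysics.QuantumFieldTheory.Balaban1983to89.T4EtaRateDefectSite (pt9Bg)
open Literature.MathematicalPhysics.QuantumFieldTheory.King1986.ContinuumLimit (eps eps_pos eps_rpow)
open Literature.MathematicalPhysics.QuantumFieldTheory.King1986.SlicePropagator (SliceKernels TwoSpacing Prop38Printed)

variable {d : ℕ}

/-! ## §3 The dictionary: on the unit-lattice carrier the typed site inequality IS the printed shape `C·e^{−δ|y−z|}·L^{−γk}` -/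

section Dictionary

variable {D₀ : ℝ}

/-- **THE TYPED SITE INEQUALITY ON THE CURVED CARRIER, UNFOLDED**: for ANY site kernel `Kd` on an index's coarse carrier and every
exponent pair `(d′, p)`, `EtaRateIneqSite d′ p Kd C δ γ U ⟺ ∀ y z, |Kd(y, z)| ≤ C·e^{−δ|y − z|}·L^{−γk}` — all sites have size `1` (the
(3.133)-prefactors read `1`) and both rate factors are King's `L^{−γk}`. [cite: Balaban1985BackgroundPropagators, (3.133) p.422 (prefactors); King1986, Prop. 3.8 (3.71) p.664 (rate factor)] [folklore] -/
theorem etaRateIneqSite_curved_iff (i : CurvedIndex d D₀) (Kd : B9.SiteKernel (curvedInstance D₀ i).gc (curvedInstance D₀ i).Bf)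
    (d' : ℕ) (p C δ γ : ℝ) (U : (curvedInstance D₀ i).Bf.Cfg) :
    EtaRateIneqSite d' p Kd C δ γ U ↔
      ∀ y z : (curvedGeo i.T i.M).Site,
        |Kd.ker U y z| ≤ C * Real.exp (-(δ * i.T.lo.dist y.1 z.1)) * (i.T.lo.L : ℝ) ^ (-(γ * i.T.lo.k)) := by
  refine forall_congr' fun y => forall_congr' fun z => ?_
  show |Kd.ker U y z| ≤ C * (curvedGeo i.T i.M).len y ^ (-p) * (curvedGeo i.T i.M).len z ^ (-(d' : ℝ)) *
      Real.exp (-(δ * (curvedGeo i.T i.M).dist y z)) *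
      max (rateFactor (curvedGeo i.T i.M) γ y) (rateFactor (curvedGeo i.T i.M) γ z) ↔ _
  rw [curvedGeo_len i.T i.M i.L_pos, curvedGeo_len i.T i.M i.L_pos, Real.one_rpow, Real.one_rpow, mul_one, mul_one,
    rateFactor_curvedGeo i.T i.M i.L_pos, rateFactor_curvedGeo i.T i.M i.L_pos, max_self, curvedGeo_dist]

/-- **A LINE-1 BOUND ⇒ NE2's TYPED SITE INEQUALITY FOR THE H-KERNEL** (every exponent pair; constants `(C·e^{δ₀D₀}, δ₀, γ)`; `C, δ₀ ≥ 0`).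
[cite: King1986, Prop. 3.8 (3.71) p.664 (first line, shape); Balaban1985BackgroundPropagators, (3.133) p.422 + Thm 3.14 pp.426–427 (typing template)] [folklore] -/
theorem etaRateIneqSite_curvedH_of_line1 (i : CurvedIndex d D₀) {C δ₀ γ : ℝ} (hC : 0 ≤ C) (hδ₀ : 0 ≤ δ₀)
    (h1 : ∀ (x' : i.T.hi.S) (z : i.T.lo.S), i.T.IsUnit z →
      |i.T.K' x' z - i.T.K (i.T.pt x') z| ≤ C * (i.T.lo.L : ℝ) ^ (-(γ * i.T.lo.k)) * Real.exp (-(δ₀ * i.T.lo.dist (i.T.pt x') z)))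
    (d' : ℕ) (p : ℝ) (U : (curvedInstance D₀ i).Bf.Cfg) :
    EtaRateIneqSite d' p (curvedHSite D₀ i) (C * Real.exp (δ₀ * D₀)) δ₀ γ U := by
  refine (etaRateIneqSite_curved_iff i _ d' p _ δ₀ γ U).mpr fun y z => ?_
  show |hEntry i.β y z| ≤ _
  rw [abs_of_nonneg (hEntry_nonneg i.β y z)]
  exact hEntry_le_of_line1 i.β hC hδ₀ h1 y z

/-- **PRINT ⇒ NE2's TYPED SITE INEQUALITY FOR THE H-KERNEL WITH THE BACKGROUND** (every exponent pair; constants `(C·e^{δ₀D₀}, δ₀, γ)`;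
`C, δ₀ ≥ 0`): `Prop38Printed i.T C δ₀ γ ⇒ EtaRateIneqSite d′ p (curvedHSite D₀ i) (C·e^{δ₀D₀}) δ₀ γ U`. [cite: King1986, Prop. 3.8 (3.71) p.664 (first line); Balaban1985BackgroundPropagators, (3.133) p.422 + Thm 3.14 pp.426–427 (typing template)] -/
theorem etaRateIneqSite_curvedH_of_prop38Printed (i : CurvedIndex d D₀) {C δ₀ γ : ℝ} (hC : 0 ≤ C) (hδ₀ : 0 ≤ δ₀)
    (h38 : Prop38Printed i.T C δ₀ γ) (d' : ℕ) (p : ℝ) (U : (curvedInstance D₀ i).Bf.Cfg) :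
    EtaRateIneqSite d' p (curvedHSite D₀ i) (C * Real.exp (δ₀ * D₀)) δ₀ γ U :=
  etaRateIneqSite_curvedH_of_line1 i hC hδ₀ (fun x' z hz => (h38.1 x' z hz).1) d' p U

/-- **PRINT ⇒ THE TYPED SITE INEQUALITY FOR THE DERIVATIVE ENTRY** (constants `((d+1)·C·e^{δ₀D₀}, δ₀, γ)`). [cite: King1986, Prop. 3.8 (3.71) p.664 (second line); Balaban1985BackgroundPropagators, (3.133) p.422 (shape)] -/
theorem etaRateIneqSite_curvedDH_of_prop38Printed (i : CurvedIndex d D₀) {C δ₀ γ : ℝ} (hC : 0 ≤ C) (hδ₀ : 0 ≤ δ₀)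
    (h38 : Prop38Printed i.T C δ₀ γ) (d' : ℕ) (p : ℝ) (U : (curvedInstance D₀ i).Bf.Cfg) :
    EtaRateIneqSite d' p (curvedDHSite D₀ i) ((d + 1) * C * Real.exp (δ₀ * D₀)) δ₀ γ U := by
  refine (etaRateIneqSite_curved_iff i _ d' p _ δ₀ γ U).mpr fun y z => ?_
  show |dhEntry i.β y z| ≤ _
  rw [abs_of_nonneg (dhEntry_nonneg i.β y z)]
  refine (dhEntry_le_of_prop38Printed i.β hC hδ₀ h38 y z).trans ?_
  have hX : 0 ≤ C * Real.exp (δ₀ * D₀) * Real.exp (-(δ₀ * i.T.lo.dist y.1 z.1)) * (i.T.lo.L : ℝ) ^ (-(γ * i.T.lo.k)) :=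
    mul_nonneg (mul_nonneg (mul_nonneg hC (Real.exp_pos _).le) (Real.exp_pos _).le) (Real.rpow_nonneg (Nat.cast_nonneg _) _)
  have hd : (d : ℝ) ≤ d + 1 := by linarith
  calc (d : ℝ) * C * Real.exp (δ₀ * D₀) * Real.exp (-(δ₀ * i.T.lo.dist y.1 z.1)) * (i.T.lo.L : ℝ) ^ (-(γ * i.T.lo.k))
      = d * (C * Real.exp (δ₀ * D₀) * Real.exp (-(δ₀ * i.T.lo.dist y.1 z.1)) * (i.T.lo.L : ℝ) ^ (-(γ * i.T.lo.k))) := by ring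
    _ ≤ (d + 1) * (C * Real.exp (δ₀ * D₀) * Real.exp (-(δ₀ * i.T.lo.dist y.1 z.1)) * (i.T.lo.L : ℝ) ^ (-(γ * i.T.lo.k))) :=
        mul_le_mul_of_nonneg_right hd hX
    _ = (d + 1) * C * Real.exp (δ₀ * D₀) * Real.exp (-(δ₀ * i.T.lo.dist y.1 z.1)) * (i.T.lo.L : ℝ) ^ (-(γ * i.T.lo.k)) := by ring

/-- **CONVERSELY: NE2's TYPED SITE INEQUALITY FOR THE H-KERNEL RETURNS (3.71) LINE 1's PRINTED SHAPE** at EVERY fine point `x′` and unit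
point `z`, with the block slack: `EtaRateIneqSite d′ p (curvedHSite D₀ i) C δ γ U` (`δ ≥ 0`) ⇒
`|a_{k+n}G^{η′}Q^*(x′, z) − a_kG^ηQ^*(x, z)| ≤ C·e^{δD₀}·L^{−γk}·e^{−δ|x − z|}` — so, on every blocked two-spacing datum, the typed site
inequality for the H-kernel's sup entry and King's printed (3.71) line 1 are the same statement up to the constants `e^{±δD₀}`.
[cite: King1986, Prop. 3.8 (3.71) p.664 (first line, shape); Balaban1985BackgroundPropagators, (3.133) p.422 (shape)] [folklore] -/
theorem line1_of_etaRateIneqSite_curvedH (i : CurvedIndex d D₀) {C δ γ : ℝ} (hδ : 0 ≤ δ) {d' : ℕ} {p : ℝ}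
    {U : (curvedInstance D₀ i).Bf.Cfg} (h : EtaRateIneqSite d' p (curvedHSite D₀ i) C δ γ U) (x' : i.T.hi.S) (z : i.T.lo.S)
    (hz : i.T.IsUnit z) :
    |i.T.K' x' z - i.T.K (i.T.pt x') z|
      ≤ C * Real.exp (δ * D₀) * (i.T.lo.L : ℝ) ^ (-(γ * i.T.lo.k)) * Real.exp (-(δ * i.T.lo.dist (i.T.pt x') z)) := by
  set y : (curvedGeo i.T i.M).Site := ⟨i.β.blk (i.T.pt x'), i.β.isUnit_blk _⟩ with hy
  have hx' : x' ∈ i.β.fibre y.1 := (i.β.mem_fibre y.1 x').2 rfl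
  have hsite := (etaRateIneqSite_curved_iff i _ d' p C δ γ U).mp h y ⟨z, hz⟩
  have hent : |(curvedHSite D₀ i).ker U y ⟨z, hz⟩| = hEntry i.β y ⟨z, hz⟩ := abs_of_nonneg (hEntry_nonneg i.β y ⟨z, hz⟩)
  rw [hent] at hsite
  have hC : 0 ≤ C * Real.exp (-(δ * i.T.lo.dist y.1 z)) * (i.T.lo.L : ℝ) ^ (-(γ * i.T.lo.k)) :=
    (hEntry_nonneg i.β y ⟨z, hz⟩).trans hsite
  have hexp := exp_dist_blk_le i.β hδ (i.T.pt x') z hz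
  -- the sign of `C·L^{−γk}`: the bound is a nonnegative number times the positive exponential
  have hCr : 0 ≤ C * (i.T.lo.L : ℝ) ^ (-(γ * i.T.lo.k)) := by
    have hE : 0 < Real.exp (-(δ * i.T.lo.dist y.1 z)) := Real.exp_pos _
    have : 0 ≤ C * (i.T.lo.L : ℝ) ^ (-(γ * i.T.lo.k)) * Real.exp (-(δ * i.T.lo.dist y.1 z)) := by
      calc (0 : ℝ) ≤ C * Real.exp (-(δ * i.T.lo.dist y.1 z)) * (i.T.lo.L : ℝ) ^ (-(γ * i.T.lo.k)) := hC
        _ = _ := by ring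
    exact nonneg_of_mul_nonneg_left this hE
  calc |i.T.K' x' z - i.T.K (i.T.pt x') z| ≤ hEntry i.β y ⟨z, hz⟩ := abs_sub_le_hEntry i.β y ⟨z, hz⟩ hx'
    _ ≤ C * Real.exp (-(δ * i.T.lo.dist y.1 z)) * (i.T.lo.L : ℝ) ^ (-(γ * i.T.lo.k)) := hsite
    _ = C * (i.T.lo.L : ℝ) ^ (-(γ * i.T.lo.k)) * Real.exp (-(δ * i.T.lo.dist (i.β.blk (i.T.pt x')) z)) := by rw [hy]; ring
    _ ≤ C * (i.T.lo.L : ℝ) ^ (-(γ * i.T.lo.k)) * (Real.exp (δ * D₀) * Real.exp (-(δ * i.T.lo.dist (i.T.pt x') z))) :=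
        mul_le_mul_of_nonneg_left hexp hCr
    _ = C * Real.exp (δ * D₀) * (i.T.lo.L : ℝ) ^ (-(γ * i.T.lo.k)) * Real.exp (-(δ * i.T.lo.dist (i.T.pt x') z)) := by ring

end Dictionary

/-! ## §4 Packaged under the node's quantifier blocks: `NE2PlusSite` ∕ `NE2ZeroSite` on Prop-3.8 families, and the readout -/

section Packaged

variable {D₀ : ℝ}

/-- **`NE2PlusSite` FOR THE H-KERNEL WITH THE BACKGROUND, FROM PRINT, ON ANY PROP-3.8 FAMILY**: for every family `D : ι → CurvedIndex d D₀`
of blocked two-spacing data obeying `Prop38Printed (D i).T C δ₀ γ` with COMMON constants `C, δ₀, γ > 0` (King: *"C depends on g, h"* — uniform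
over the regular backgrounds, i.e. over the index), `NE2PlusSite d′ p c35` holds for the sup-over-the-block η-difference entries of the
H-kernel, every `(d′, p, c35)`, constants `(M₅, δ, a₀, C′, γ′) = (1, δ₀, 1, C·e^{δ₀D₀}, γ)`.  HONEST SCOPE (a)–(d), (i)–(iii) of the header.
[cite: King1986, Prop. 3.8 (3.71) p.664; Balaban1985BackgroundPropagators, (3.133) p.422 + Thm 3.2 (3.48) p.398 + Thm 3.14 pp.426–427 (quantifier template)] -/
theorem ne2PlusSite_curvedH_of_prop38Printed {ι : Type} (D : ι → CurvedIndex d D₀) {C δ₀ γ : ℝ} (hC : 0 < C) (hδ₀ : 0 < δ₀)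
    (hγ : 0 < γ) (h38 : ∀ i, Prop38Printed (D i).T C δ₀ γ) (d' : ℕ) (p c35 : ℝ) :
    NE2PlusSite d' p c35 (fun i => curvedInstance D₀ (D i)) (fun i => curvedHSite D₀ (D i)) :=
  ⟨1, δ₀, 1, C * Real.exp (δ₀ * D₀), γ, one_pos, hδ₀, one_pos, mul_pos hC (Real.exp_pos _), hγ,
    fun i _ _ _ _ U _ => etaRateIneqSite_curvedH_of_prop38Printed (D i) hC.le hδ₀.le (h38 i) d' p U⟩

/-- **`NE2PlusSite` FOR THE DERIVATIVE ENTRY, FROM PRINT, ON ANY PROP-3.8 FAMILY** (constant `(d+1)·C·e^{δ₀D₀}`). [cite: King1986, Prop. 3.8 (3.71) p.664 (second line); Balaban1985BackgroundPropagators, (3.133) p.422 + Thm 3.14 pp.426–427 (quantifier template)] -/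
theorem ne2PlusSite_curvedDH_of_prop38Printed {ι : Type} (D : ι → CurvedIndex d D₀) {C δ₀ γ : ℝ} (hC : 0 < C) (hδ₀ : 0 < δ₀)
    (hγ : 0 < γ) (h38 : ∀ i, Prop38Printed (D i).T C δ₀ γ) (d' : ℕ) (p c35 : ℝ) :
    NE2PlusSite d' p c35 (fun i => curvedInstance D₀ (D i)) (fun i => curvedDHSite D₀ (D i)) :=
  ⟨1, δ₀, 1, (d + 1) * C * Real.exp (δ₀ * D₀), γ, one_pos, hδ₀, one_pos,
    mul_pos (mul_pos (by positivity) hC) (Real.exp_pos _), hγ,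
    fun i _ _ _ _ U _ => etaRateIneqSite_curvedDH_of_prop38Printed (D i) hC.le hδ₀.le (h38 i) d' p U⟩

/-- `NE2ZeroSite` for the H-kernel with the background, on any Prop-3.8 family (the site twin at the sort's one configuration).
[cite: King1986, Prop. 3.8 (3.71) p.664] -/
theorem ne2ZeroSite_curvedH_of_prop38Printed {ι : Type} (D : ι → CurvedIndex d D₀) {C δ₀ γ : ℝ} (hC : 0 < C) (hδ₀ : 0 < δ₀)
    (hγ : 0 < γ) (h38 : ∀ i, Prop38Printed (D i).T C δ₀ γ) (d' : ℕ) (p : ℝ) :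
    NE2ZeroSite d' p (fun i => curvedInstance D₀ (D i)) (fun i => curvedHSite D₀ (D i)) :=
  ne2ZeroSite_of_ne2PlusSite (c35 := 0) (fun _ _ _ => trivial) (ne2PlusSite_curvedH_of_prop38Printed D hC hδ₀ hγ h38 d' p 0)

/-- WHAT BAŁABAN'S CASE ADDS AT THE TYPE LEVEL, item (c) of the header: on the curved family's one-point background sort (the background is a
parameter of the datum; (3.35) reads `True`) `NE2PlusSite` IS `NE2ZeroSite` (part 2 §3's generic `ne2PlusSite_iff_ne2ZeroSite`) — Bałaban's
`H_k(U)` adds the live quantifier `∀ U, Reg335 c35 α₀ U → …` INSIDE one instance. [cite: Balaban1985BackgroundPropagators, (3.35) p.396, (3.133) p.422, Thm 3.4 p.400] [folklore] -/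
theorem ne2PlusSite_curvedH_iff_zero {ι : Type} (D : ι → CurvedIndex d D₀) (d' : ℕ) (p c35 : ℝ) :
    (NE2PlusSite d' p c35 (fun i => curvedInstance D₀ (D i)) (fun i => curvedHSite D₀ (D i)) ↔
        NE2ZeroSite d' p (fun i => curvedInstance D₀ (D i)) (fun i => curvedHSite D₀ (D i))) ∧
      (NE2PlusSite d' p c35 (fun i => curvedInstance D₀ (D i)) (fun i => curvedDHSite D₀ (D i)) ↔
        NE2ZeroSite d' p (fun i => curvedInstance D₀ (D i)) (fun i => curvedDHSite D₀ (D i))) :=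
  ⟨ne2PlusSite_iff_ne2ZeroSite d' p c35 (fun _ => instSubsingletonPUnit) (fun _ _ _ => trivial),
    ne2PlusSite_iff_ne2ZeroSite d' p c35 (fun _ => instSubsingletonPUnit) (fun _ _ _ => trivial)⟩

/-- **`NE2PlusSite` FROM LINE-1 BOUNDS WITH COMMON CONSTANTS, ON ANY FAMILY** — the minimal hypothesis: every member satisfies (3.71) line 1's
shape with the same `C, δ₀, γ > 0`. [cite: King1986, Prop. 3.8 (3.71) p.664 (first line, shape); Balaban1985BackgroundPropagators, Thm 3.14 pp.426–427 (quantifier template)] [folklore] -/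
theorem ne2PlusSite_curvedH_of_line1 {ι : Type} (D : ι → CurvedIndex d D₀) {C δ₀ γ : ℝ} (hC : 0 < C) (hδ₀ : 0 < δ₀) (hγ : 0 < γ)
    (h1 : ∀ (i : ι) (x' : (D i).T.hi.S) (z : (D i).T.lo.S), (D i).T.IsUnit z →
      |(D i).T.K' x' z - (D i).T.K ((D i).T.pt x') z|
        ≤ C * ((D i).T.lo.L : ℝ) ^ (-(γ * (D i).T.lo.k)) * Real.exp (-(δ₀ * (D i).T.lo.dist ((D i).T.pt x') z)))
    (d' : ℕ) (p c35 : ℝ) :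
    NE2PlusSite d' p c35 (fun i => curvedInstance D₀ (D i)) (fun i => curvedHSite D₀ (D i)) :=
  ⟨1, δ₀, 1, C * Real.exp (δ₀ * D₀), γ, one_pos, hδ₀, one_pos, mul_pos hC (Real.exp_pos _), hγ,
    fun i _ _ _ _ U _ => etaRateIneqSite_curvedH_of_line1 (D i) hC.le hδ₀.le (h1 i) d' p U⟩

/-- **THE READOUT: THE PACKAGED TYPE RETURNS (3.71) LINE 1's SHAPE, UNIFORMLY ABOVE THE CUBE-SIZE THRESHOLD** — a proof of `NE2PlusSite d′ p c35`
for the H-kernel entries on ANY family yields a threshold `M₅` and constants `C′, δ, γ′ > 0` such that every member with `M ≥ M₅` satisfies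
`|a_{k+n}G^{η′}Q^*(x′, z) − a_kG^ηQ^*(x, z)| ≤ C′·e^{δD₀}·L^{−γ′k}·e^{−δ|x − z|}` at every fine point and unit point, with the SAME constants
(the threshold is [B9] Thm 3.1's «for M ≥ M₁» frame, p. 397; `α₀ := a₀∕M`): the packaged type carries exactly line 1's content up to
constants — neither vacuous nor more. [cite: King1986, Prop. 3.8 (3.71) p.664 (first line, shape); Balaban1985BackgroundPropagators, Thm 3.1 p.397 (threshold frame)] [folklore] -/
theorem exists_line1_of_ne2PlusSite {ι : Type} (D : ι → CurvedIndex d D₀) {d' : ℕ} {p c35 : ℝ}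
    (h : NE2PlusSite d' p c35 (fun i => curvedInstance D₀ (D i)) (fun i => curvedHSite D₀ (D i))) :
    ∃ M₅ C' δ γ' : ℝ, 0 < C' ∧ 0 < δ ∧ 0 < γ' ∧ ∀ i : ι, M₅ ≤ (D i).M →
      ∀ (x' : (D i).T.hi.S) (z : (D i).T.lo.S), (D i).T.IsUnit z →
        |(D i).T.K' x' z - (D i).T.K ((D i).T.pt x') z|
          ≤ C' * Real.exp (δ * D₀) * ((D i).T.lo.L : ℝ) ^ (-(γ' * (D i).T.lo.k)) *
            Real.exp (-(δ * (D i).T.lo.dist ((D i).T.pt x') z)) := by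
  obtain ⟨M₅, δ, a₀, C', γ', hM, hδ, ha, hC', hγ', H⟩ := h
  refine ⟨M₅, C', δ, γ', hC', hδ, hγ', fun i hMi x' z hz => ?_⟩
  have hMpos : (0 : ℝ) < (D i).M := lt_of_lt_of_le hM hMi
  have hα : 0 < a₀ / (D i).M := div_pos ha hMpos
  have hsite : EtaRateIneqSite d' p (curvedHSite D₀ (D i)) C' δ γ' () :=
    H i hMi (a₀ / (D i).M) hα (le_of_eq (mul_div_cancel₀ a₀ hMpos.ne')) () trivial
  exact line1_of_etaRateIneqSite_curvedH (D i) hδ.le hsite x' z hz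

end Packaged

/-! ## §5 The family is inhabited: the one-point zero-kernel member -/

section Member

/-- The one-point slice data with zero kernels (`L = 2`, `k = 0`). [folklore] -/
@[reducible] def ptSlice (d : ℕ) : SliceKernels d where
  S := Unit
  B := Unit
  dist := fun _ _ => 0
  distBlockBond := fun _ _ _ => 0
  L := 2
  k := 0
  G := fun _ _ _ => 0
  dG := fun _ _ _ _ => 0
  Gc := fun _ _ _ => 0

/-- The one-point two-spacing datum with zero kernels (`n = 0`). [folklore] -/
@[reducible] def ptTwoSpacing (d : ℕ) : TwoSpacing d where
  lo := ptSlice d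
  hi := ptSlice d
  n := 0
  k_hi := rfl
  L_hi := rfl
  pt := fun x => x
  bd := fun b => b
  IsUnit := fun _ => True
  K := fun _ _ => 0
  dK := fun _ _ _ => 0
  K' := fun _ _ => 0
  dK' := fun _ _ _ => 0

/-- Its unit-block structure (one block, one fine point; any slack `D₀ ≥ 0`). [folklore] -/
def ptBlocking (d : ℕ) {D₀ : ℝ} (hD₀ : 0 ≤ D₀) : UnitBlocking (ptTwoSpacing d) D₀ where
  blk := fun x => x
  isUnit_blk := fun _ => trivial
  blk_of_isUnit := fun _ _ => rfl
  fibre := fun _ => {()}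
  mem_fibre := fun _ _ => by simp
  fibre_nonempty := fun _ _ => Finset.singleton_nonempty _
  abs_dist_blk_sub_le := fun _ _ _ => by
    show |(0 : ℝ) - 0| ≤ D₀
    simpa using hD₀

/-- The zero kernels obey Prop. 3.8's schema for every `C ≥ 0` (the Hölder clauses are vacuous at distance `0`). [folklore] -/
theorem prop38Printed_pt (d : ℕ) {C : ℝ} (hC : 0 ≤ C) (δ₀ γ : ℝ) : Prop38Printed (ptTwoSpacing d) C δ₀ γ := by
  refine ⟨fun x' z _ => ⟨?_, fun μ => ?_⟩, fun α _ _ x' y' z _ hxy _ => absurd hxy (lt_irrefl _)⟩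
  · show |(0 : ℝ) - 0| ≤ C * ((2 : ℕ) : ℝ) ^ (-(γ * ((0 : ℕ) : ℝ))) * Real.exp (-(δ₀ * 0))
    simp [hC]
  · show |(0 : ℝ) - 0| ≤ C * ((2 : ℕ) : ℝ) ^ (-(γ * ((0 : ℕ) : ℝ))) * Real.exp (-(δ₀ * 0))
    simp [hC]

/-- The index type of the curved family is inhabited (`D₀ ≥ 0`). [folklore] -/
theorem curvedIndex_nonempty (d : ℕ) {D₀ : ℝ} (hD₀ : 0 ≤ D₀) : Nonempty (CurvedIndex d D₀) :=
  ⟨⟨ptTwoSpacing d, ptBlocking d hD₀, 1, le_rfl, Nat.one_lt_two⟩⟩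

/-- THE ONE-POINT MEMBER AT EVERY CUBE SIZE `M ≥ 1`: a small, co-final family on which §4's producer applies. [folklore] -/
def ptFamily (d : ℕ) {D₀ : ℝ} (hD₀ : 0 ≤ D₀) : {M : ℝ // 1 ≤ M} → CurvedIndex d D₀ :=
  fun M => ⟨ptTwoSpacing d, ptBlocking d hD₀, M.1, M.2, Nat.one_lt_two⟩

/-- SMOKE TEST: the producer's hypotheses are jointly satisfiable on a nonempty family — `NE2PlusSite` holds on the one-point family
(zero kernels, every `C > 0`). [folklore] -/
theorem ne2PlusSite_ptFamily (d : ℕ) {D₀ : ℝ} (hD₀ : 0 ≤ D₀) {C δ₀ γ : ℝ} (hC : 0 < C) (hδ₀ : 0 < δ₀) (hγ : 0 < γ)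
    (d' : ℕ) (p c35 : ℝ) :
    NE2PlusSite d' p c35 (fun M => curvedInstance D₀ (ptFamily d hD₀ M)) (fun M => curvedHSite D₀ (ptFamily d hD₀ M)) :=
  ne2PlusSite_curvedH_of_prop38Printed (ptFamily d hD₀) hC hδ₀ hγ (fun _ => prop38Printed_pt d hC.le δ₀ γ) d' p c35

end Member

end Summit.QuantumFields.YangMills.BalabanUVNodes.N15KingModelRung.Curved

end
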